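import Summits.HodgeConjecture.CorCM.IrreducibleOddWeightsIsotypicSplittingFamiliesCMFields
import HarnessLib

/-!
# Isotypic cells, XIII: LABELS BY DIMENSION — when constituents of different labels have different dimensions the
# non-embedding hypotheses are automatic: `defect = Σ_c dim(S(p⁰_c) ∩ S(p¹_c))` with `δ(c) ∣` each summand

COR-CM (cell `pub-hodgecm2`, binder seat `b16` gen 70, count-neutral claim ISOTYPIC SPLITTING OF THE DEFECT, file I13 —
abstract `G`-set level, type ranks and CM fields; theorems only, no definition, no named fact, no `sorry`).  NEW as
stated, hence under `Summits/`.  HONEST FRAMING: linear algebra of translates of functions on finite `G`-sets (files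
I1–I12) and its dress for CM fields (Kubota–Dodson rank = `dim MT`, Pohlmann); nothing about Hodge classes is asserted;
`HC_CM` is neither used nor asserted.

THE POINT.  Files I4/I11/I12 split the meet `S(w₀) ∩ S(w₁)` over labelled classes of constituents under the hypothesis
that no non-zero constituent EMBEDS equivariantly into a constituent with a different label.  The cheapest labelling
is BY DIMENSION: an equivariant embedding of a non-zero stable irreducible `A` into a stable irreducible `B` is onto
(`L(A)` is a non-zero stable subspace of `B`), so `dim A = dim B` (`false_of_embed_of_finrank_ne`).  Hence, for ANY
labelling `c_κ : J_κ → C` with `dim A^κ_j = δ(c_κ j)` for an INJECTIVE `δ : C → ℕ` (labels = dimensions, possibly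
refined no further), with NO Hom computation at all:

* **`finrank_span_shadowCoeff_sum_inf_eq_sum_of_finrank_eq`**:
  `dim(S(Σ_c p⁰_c) ∩ S(Σ_c p¹_c)) = Σ_c dim(S(p⁰_c) ∩ S(p¹_c))`, and
  **`dvd_finrank_span_shadowCoeff_inf_of_finrank_eq`**: `δ(c) ∣ dim(S(p⁰_c) ∩ S(p¹_c))` (file I5);
* type ranks **`typeRank_add_typeRank_eq_add_sum_of_finrank_eq`** and CM fields
  **`cmTypeRank_add_cmTypeRank_eq_add_sum_of_finrank_eq`** ∕ `exists_…_of_antiWeights_le`: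
  **`dim Hg(A₀)+dim Hg(A₁)−dim Hg(A₀×A₁) = Σ_d (dimension-d part)`, the dimension-`d` part a MULTIPLE of `d`** —
  for every pair of CM types, over any (TR) pivots, given only decompositions of `Anti(T₀)`, `Anti(T₁)` into stable
  irreducibles with their dimensions.  Finer labels (isomorphism classes inside one dimension) sharpen the summands
  (I11/I12, and I9/I10 for absolutely irreducible classes).

## References

* [Serre1977] J.-P. Serre, *Linear Representations of Finite Groups*, GTM 42, §2.2 (Schur), §2.6.
* [Lang2002] S. Lang, *Algebra*, 3rd ed., XVII §1 Prop. 1.1, XVII §3.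
* [Gordon1999HodgeAVSurvey] B. B. Gordon, *A survey of the Hodge conjecture for abelian varieties*, §3 Theorem (proof),
  7.5–7.7, 9.4.3.
-/

set_option autoImplicit false

noncomputable section

open scoped BigOperators Classical

universe u u' u₀ u₁ v v' v'' w

namespace Summit.HodgeConjecture.CorCM.IrrOdd

open Literature.NumberTheory.ComplexMultiplication

variable {G : Type w} [Group G] {Y₀ : Type v'} [MulAction G Y₀] [Fintype Y₀]
  {Y₁ : Type v''} [MulAction G Y₁] [Fintype Y₁]

/-! ### §1 Irreducibles of different dimensions do not embed -/

omit [Fintype Y₁] in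
/-- **AN EQUIVARIANT EMBEDDING OF A NON-ZERO STABLE IRREDUCIBLE INTO A STABLE IRREDUCIBLE IS ONTO**, so the dimensions
agree: with `dim A ≠ dim B` there is no linear `L` mapping `A` into `B`, injective and equivariant on `A`.
[cite: Serre1977, §2.2] [cite: Lang2002, XVII §1 Prop. 1.1] -/
theorem false_of_embed_of_finrank_ne {A : Submodule ℚ (Y₀ → ℚ)} {B : Submodule ℚ (Y₁ → ℚ)}
    (hAst : ∀ (k : G) (a : Y₀ → ℚ), a ∈ A → (fun y => a (k • y)) ∈ A)
    (hBirr : ∀ W : Submodule ℚ (Y₁ → ℚ), W ≤ B → W ≠ ⊥ →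
      (∀ (k : G) (f : Y₁ → ℚ), f ∈ W → (fun y => f (k • y)) ∈ W) → W = B)
    (hne : Module.finrank ℚ A ≠ Module.finrank ℚ B) (L : (Y₀ → ℚ) →ₗ[ℚ] (Y₁ → ℚ)) (hA0 : A ≠ ⊥)
    (hL : ∀ a ∈ A, L a ∈ B) (hLinj : ∀ a ∈ A, L a = 0 → a = 0)
    (hLeq : ∀ (g : G) (a : Y₀ → ℚ), a ∈ A → L (fun y => a (g • y)) = fun y => L a (g • y)) : False := by
  haveI : FiniteDimensional ℚ A := Submodule.finiteDimensional_of_le le_top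
  -- the image `L(A)` is a non-zero stable subspace of `B`, hence all of `B`
  have hmap : A.map L = B := by
    refine hBirr _ (fun x hx => ?_) (fun h0 => hA0 ?_) (fun k f hf => ?_)
    · obtain ⟨a, ha, rfl⟩ := Submodule.mem_map.1 hx
      exact hL a ha
    · rw [eq_bot_iff]
      intro a ha
      have hLa : L a ∈ A.map L := Submodule.mem_map_of_mem ha
      rw [h0, Submodule.mem_bot] at hLa
      rw [Submodule.mem_bot]
      exact hLinj a ha hLa
    · obtain ⟨a, ha, rfl⟩ := Submodule.mem_map.1 hf
      exact ⟨fun y => a (k • y), hAst k a ha, hLeq k a ha⟩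
  -- `L` is injective on `A`: `dim A = dim L(A) = dim B`
  have hker : LinearMap.ker (L.domRestrict A) = ⊥ := by
    rw [eq_bot_iff]
    intro a ha
    have ha' : L (a : Y₀ → ℚ) = 0 := ha
    rw [Submodule.mem_bot]
    exact Subtype.ext (hLinj a a.2 ha')
  have h := LinearMap.finrank_range_add_finrank_ker (L.domRestrict A)
  rw [hker, finrank_bot, add_zero, LinearMap.range_domRestrict, hmap] at h
  exact hne h.symm

/-! ### §2 The meet splits by dimension -/

/-- **THE DEFECT SPLITS OVER LABELS THAT SEPARATE DIMENSIONS**: constituents labelled by `c_κ : J_κ → C` with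
`dim A^κ_j = δ(c_κ j)`, `δ` injective; class components `p^κ_c`.  Then
`dim(S(Σ_c p⁰_c) ∩ S(Σ_c p¹_c)) = Σ_c dim(S(p⁰_c) ∩ S(p¹_c))` — no embedding hypothesis is needed.
[cite: Serre1977, §2.6] [cite: Gordon1999HodgeAVSurvey, §3 Theorem (proof), 7.5–7.7] -/
theorem finrank_span_shadowCoeff_sum_inf_eq_sum_of_finrank_eq {C : Type u} [Fintype C] {J₀ : Type u₀} {J₁ : Type u₁}
    [Fintype J₀] [Fintype J₁] (c₀ : J₀ → C) (c₁ : J₁ → C) {δ : C → ℕ} (hδ : Function.Injective δ)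
    {A₀ : J₀ → Submodule ℚ (Y₀ → ℚ)} {A₁ : J₁ → Submodule ℚ (Y₁ → ℚ)}
    (hA₀st : ∀ (j : J₀) (k : G) (a : Y₀ → ℚ), a ∈ A₀ j → (fun y => a (k • y)) ∈ A₀ j)
    (hA₀irr : ∀ (j : J₀) (W : Submodule ℚ (Y₀ → ℚ)), W ≤ A₀ j → W ≠ ⊥ →
      (∀ (k : G) (f : Y₀ → ℚ), f ∈ W → (fun y => f (k • y)) ∈ W) → W = A₀ j)
    (hA₁st : ∀ (j : J₁) (k : G) (a : Y₁ → ℚ), a ∈ A₁ j → (fun y => a (k • y)) ∈ A₁ j)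
    (hA₁irr : ∀ (j : J₁) (W : Submodule ℚ (Y₁ → ℚ)), W ≤ A₁ j → W ≠ ⊥ →
      (∀ (k : G) (f : Y₁ → ℚ), f ∈ W → (fun y => f (k • y)) ∈ W) → W = A₁ j)
    (hd₀ : ∀ j, Module.finrank ℚ (A₀ j) = δ (c₀ j)) (hd₁ : ∀ j, Module.finrank ℚ (A₁ j) = δ (c₁ j))
    {p₀ : C → (Y₀ → ℚ)} {p₁ : C → (Y₁ → ℚ)}
    (hp₀ : ∀ c, p₀ c ∈ ⨆ j : {j // c₀ j = c}, A₀ j.1) (hp₁ : ∀ c, p₁ c ∈ ⨆ j : {j // c₁ j = c}, A₁ j.1) :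
    Module.finrank ℚ ↥(Submodule.span ℚ (Set.range fun y : Y₀ => fun g : G => (∑ c, p₀ c) (g • y)) ⊓
        Submodule.span ℚ (Set.range fun y : Y₁ => fun g : G => (∑ c, p₁ c) (g • y))) =
      ∑ c, Module.finrank ℚ ↥(Submodule.span ℚ (Set.range fun y : Y₀ => fun g : G => p₀ c (g • y)) ⊓
        Submodule.span ℚ (Set.range fun y : Y₁ => fun g : G => p₁ c (g • y))) :=
  finrank_span_shadowCoeff_sum_inf_eq_sum_of_classes c₀ c₁ hA₀st hA₀irr hA₁st hA₁irr
    (fun j k L hne hA0 hL hinj heq => false_of_embed_of_finrank_ne (hA₀st j) (hA₀irr k)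
      (by rw [hd₀, hd₀]; exact fun h => hne (hδ h)) L hA0 hL hinj heq)
    (fun j k L hne hA0 hL hinj heq => false_of_embed_of_finrank_ne (hA₀st j) (hA₁irr k)
      (by rw [hd₀, hd₁]; exact fun h => hne (hδ h)) L hA0 hL hinj heq)
    (fun j k L hne hA0 hL hinj heq => false_of_embed_of_finrank_ne (hA₁st j) (hA₀irr k)
      (by rw [hd₁, hd₀]; exact fun h => hne (hδ h)) L hA0 hL hinj heq)
    (fun j k L hne hA0 hL hinj heq => false_of_embed_of_finrank_ne (hA₁st j) (hA₁irr k)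
      (by rw [hd₁, hd₁]; exact fun h => hne (hδ h)) L hA0 hL hinj heq)
    hp₀ hp₁

omit [Fintype Y₁] in
/-- **EACH SUMMAND IS A MULTIPLE OF ITS DIMENSION**: `δ(c) ∣ dim(S(p⁰_c) ∩ S(w₁))` for the class component `p⁰_c` of a
class all of whose constituents have dimension `δ(c)`, and ANY partner `w₁` (file I5). [cite: Serre1977, §2.6]
[cite: Gordon1999HodgeAVSurvey, §3 Theorem (proof)] -/
theorem dvd_finrank_span_shadowCoeff_inf_of_finrank_eq {C : Type u} {J₀ : Type u₀} [Fintype J₀] (c₀ : J₀ → C)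
    {δ : C → ℕ} {A₀ : J₀ → Submodule ℚ (Y₀ → ℚ)}
    (hA₀st : ∀ (j : J₀) (k : G) (a : Y₀ → ℚ), a ∈ A₀ j → (fun y => a (k • y)) ∈ A₀ j)
    (hA₀irr : ∀ (j : J₀) (W : Submodule ℚ (Y₀ → ℚ)), W ≤ A₀ j → W ≠ ⊥ →
      (∀ (k : G) (f : Y₀ → ℚ), f ∈ W → (fun y => f (k • y)) ∈ W) → W = A₀ j)
    (hd₀ : ∀ j, Module.finrank ℚ (A₀ j) = δ (c₀ j)) (c : C) {p₀ : Y₀ → ℚ}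
    (hp₀ : p₀ ∈ ⨆ j : {j // c₀ j = c}, A₀ j.1) (w₁ : Y₁ → ℚ) :
    δ c ∣ Module.finrank ℚ ↥(Submodule.span ℚ (Set.range fun y : Y₀ => fun g : G => p₀ (g • y)) ⊓
        Submodule.span ℚ (Set.range fun y : Y₁ => fun g : G => w₁ (g • y))) :=
  dvd_finrank_span_shadowCoeff_inf_span_shadowCoeff_of_class (A₀ := fun j : {j // c₀ j = c} => A₀ j.1)
    (fun j k a ha => hA₀st j.1 k a ha) (fun j W hW hW0 hWst => hA₀irr j.1 W hW hW0 hWst)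
    (fun j => by rw [hd₀ j.1, j.2]) hp₀ w₁

/-! ### §3 Type ranks -/

section TypeRanks

variable {I : Type u} {E : I → Type v} [∀ i, MulAction G (E i)] [∀ i, Fintype (E i)] [Fintype I] [∀ i, Nonempty (E i)]

/-- **THE DEFECT BY DIMENSION (type ranks).**  Two slots with equivariant pivots refining the trace classes; the shadows
lie in sums of stable irreducible constituents labelled so that labels separate dimensions (`dim A^κ_j = δ(c_κ j)`, `δ`
injective).  Then class components `p^κ_c` exist with `w_κ = Σ_c p^κ_c`,
**`rank Φ₀ + rank Φ₁ = rank(Φ₀,Φ₁) + 1 + Σ_c dim(S(p⁰_c) ∩ S(p¹_c))`** and **`δ(c) ∣ dim(S(p⁰_c) ∩ S(p¹_c))`** for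
every `c`. [cite: Gordon1999HodgeAVSurvey, §3 Theorem, 7.5–7.7 and 9.4.3] [cite: Serre1977, §2.6] -/
theorem exists_typeRank_add_typeRank_eq_add_sum_of_finrank_eq {ρ : G} {Φ : ∀ i, Set (E i)}
    (h : ∀ i, IsCMTypeWith ρ (Φ i)) {i₀ i₁ : I} (hI : ∀ j, j = i₀ ∨ j = i₁) (h01 : i₀ ≠ i₁)
    (r₀ : E i₀ → Y₀) (r₁ : E i₁ → Y₁) (hr₀ : ∀ (g : G) (x : E i₀), r₀ (g • x) = g • r₀ x)
    (hr₁ : ∀ (g : G) (x : E i₁), r₁ (g • x) = g • r₁ x)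
    (hfine₀ : ∀ x x' : E i₀, r₀ x = r₀ x' → ∃ n : G, (∀ y : E i₁, n • y = y) ∧ n • x = x')
    (hfine₁ : ∀ x x' : E i₁, r₁ x = r₁ x' → ∃ n : G, (∀ y : E i₀, n • y = y) ∧ n • x = x')
    {C : Type u'} [Fintype C] {J₀ : Type u₀} {J₁ : Type u₁} [Fintype J₀] [Fintype J₁] (c₀ : J₀ → C) (c₁ : J₁ → C)
    {δ : C → ℕ} (hδ : Function.Injective δ)
    {A₀ : J₀ → Submodule ℚ (Y₀ → ℚ)} {A₁ : J₁ → Submodule ℚ (Y₁ → ℚ)}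
    (hA₀st : ∀ (j : J₀) (k : G) (a : Y₀ → ℚ), a ∈ A₀ j → (fun y => a (k • y)) ∈ A₀ j)
    (hA₀irr : ∀ (j : J₀) (W : Submodule ℚ (Y₀ → ℚ)), W ≤ A₀ j → W ≠ ⊥ →
      (∀ (k : G) (f : Y₀ → ℚ), f ∈ W → (fun y => f (k • y)) ∈ W) → W = A₀ j)
    (hA₁st : ∀ (j : J₁) (k : G) (a : Y₁ → ℚ), a ∈ A₁ j → (fun y => a (k • y)) ∈ A₁ j)
    (hA₁irr : ∀ (j : J₁) (W : Submodule ℚ (Y₁ → ℚ)), W ≤ A₁ j → W ≠ ⊥ →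
      (∀ (k : G) (f : Y₁ → ℚ), f ∈ W → (fun y => f (k • y)) ∈ W) → W = A₁ j)
    (hd₀ : ∀ j, Module.finrank ℚ (A₀ j) = δ (c₀ j)) (hd₁ : ∀ j, Module.finrank ℚ (A₁ j) = δ (c₁ j))
    (hw₀ : (fun y : Y₀ => ∑ x ∈ Finset.univ.filter (fun x => r₀ x = y), antiVec (Φ i₀) (1 : G) x) ∈ ⨆ j, A₀ j)
    (hw₁ : (fun y : Y₁ => ∑ x ∈ Finset.univ.filter (fun x => r₁ x = y), antiVec (Φ i₁) (1 : G) x) ∈ ⨆ j, A₁ j) :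
    ∃ (p₀ : C → (Y₀ → ℚ)) (p₁ : C → (Y₁ → ℚ)),
      (∀ c, p₀ c ∈ ⨆ j : {j // c₀ j = c}, A₀ j.1) ∧ (∀ c, p₁ c ∈ ⨆ j : {j // c₁ j = c}, A₁ j.1) ∧
      (fun y : Y₀ => ∑ x ∈ Finset.univ.filter (fun x => r₀ x = y), antiVec (Φ i₀) (1 : G) x) = ∑ c, p₀ c ∧
      (fun y : Y₁ => ∑ x ∈ Finset.univ.filter (fun x => r₁ x = y), antiVec (Φ i₁) (1 : G) x) = ∑ c, p₁ c ∧
      typeRank G (Φ i₀) + typeRank G (Φ i₁) = typeRank G (sigmaType Φ) + 1 +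
        ∑ c, Module.finrank ℚ ↥(Submodule.span ℚ (Set.range fun y : Y₀ => fun g : G => p₀ c (g • y)) ⊓
          Submodule.span ℚ (Set.range fun y : Y₁ => fun g : G => p₁ c (g • y))) ∧
      ∀ c, δ c ∣ Module.finrank ℚ ↥(Submodule.span ℚ (Set.range fun y : Y₀ => fun g : G => p₀ c (g • y)) ⊓
          Submodule.span ℚ (Set.range fun y : Y₁ => fun g : G => p₁ c (g • y))) := by
  obtain ⟨p₀, p₁, hp₀, hp₁, hw₀', hw₁', hrank⟩ := exists_typeRank_add_typeRank_eq_add_sum_of_classes h hI h01 r₀ r₁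
    hr₀ hr₁ hfine₀ hfine₁ c₀ c₁ hA₀st hA₀irr hA₁st hA₁irr
    (fun j k L hne hA0 hL hinj heq => false_of_embed_of_finrank_ne (hA₀st j) (hA₀irr k)
      (by rw [hd₀, hd₀]; exact fun h => hne (hδ h)) L hA0 hL hinj heq)
    (fun j k L hne hA0 hL hinj heq => false_of_embed_of_finrank_ne (hA₀st j) (hA₁irr k)
      (by rw [hd₀, hd₁]; exact fun h => hne (hδ h)) L hA0 hL hinj heq)
    (fun j k L hne hA0 hL hinj heq => false_of_embed_of_finrank_ne (hA₁st j) (hA₀irr k)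
      (by rw [hd₁, hd₀]; exact fun h => hne (hδ h)) L hA0 hL hinj heq)
    (fun j k L hne hA0 hL hinj heq => false_of_embed_of_finrank_ne (hA₁st j) (hA₁irr k)
      (by rw [hd₁, hd₁]; exact fun h => hne (hδ h)) L hA0 hL hinj heq)
    hw₀ hw₁
  exact ⟨p₀, p₁, hp₀, hp₁, hw₀', hw₁', hrank, fun c =>
    dvd_finrank_span_shadowCoeff_inf_of_finrank_eq c₀ hA₀st hA₀irr hd₀ c (hp₀ c) (p₁ c)⟩

end TypeRanks

end Summit.HodgeConjecture.CorCM.IrrOdd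

/-! ### §4 CM fields -/

open CategoryTheory CategoryTheory.Limits NumberField Module IntermediateField

namespace Summit.HodgeConjecture.CorCM

open Literature.NumberTheory.ComplexMultiplication
open Literature.AlgebraicGeometry.Motives (AbelianVariety CMType)
open Literature.AlgebraicGeometry.Motives.AbelianVariety
open Literature.AlgebraicGeometry.HodgeTheory
open Literature.AlgebraicGeometry.ComplexMultiplication (IsCMTypeRealisation)
open Literature.AlgebraicGeometry.Pohlmann1968

variable {I : Type} [Fintype I] {K : I → Type} [∀ i, Field (K i)] [∀ i, NumberField (K i)] [∀ i, IsCMField (K i)]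
  {T₀ : Type} [Field T₀] [NumberField T₀] {T₁ : Type} [Field T₁] [NumberField T₁]

/-- **THE DEFECT BY DIMENSION (CM fields).**  `T₀ ⊆ K_{i₀}`, `T₁ ⊆ K_{i₁}` subfields containing the traces (TR);
`Anti(T₀) ≤ Σ_j A⁰_j`, `Anti(T₁) ≤ Σ_j A¹_j` with `Aut(ℂ)`-stable irreducible `A^κ_j` labelled so that labels separate
dimensions (`dim A^κ_j = δ(c_κ j)`, `δ` injective — e.g. `C ⊆ ℕ` the set of dimensions, `δ` the inclusion).  Then for
EVERY pair of CM types the shadows have class components `p^κ_c` with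
**`cmTypeRank Φ₀ + cmTypeRank Φ₁ = cmFamilyRank Φ + 1 + Σ_c dim(S(p⁰_c) ∩ S(p¹_c))`** and
**`δ(c) ∣ dim(S(p⁰_c) ∩ S(p¹_c))`**: `dim Hg(A₀)+dim Hg(A₁)−dim Hg(A₀×A₁) = Σ_d m_d·d` canonically, `d` over the
dimensions of the odd irreducible constituents. [cite: Gordon1999HodgeAVSurvey, §3 Theorem, 7.5–7.7 and 9.4.3]
[cite: Serre1977, §2.6] -/
theorem exists_cmTypeRank_add_cmTypeRank_eq_add_sum_of_finrank_eq {i₀ i₁ : I} (h01 : i₀ ≠ i₁)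
    (hI : ∀ l, l = i₀ ∨ l = i₁) (Φ : ∀ i, CMType (K i)) [Algebra T₀ (K i₀)] [Algebra T₁ (K i₁)]
    (htr₀ : ∀ (a : K i₀ →+* ℂ) (k : K i₀), a k ∈ normalClosure ℚ (K i₁) ℂ → k ∈ Set.range (algebraMap T₀ (K i₀)))
    (htr₁ : ∀ (b : K i₁ →+* ℂ) (k : K i₁), b k ∈ normalClosure ℚ (K i₀) ℂ → k ∈ Set.range (algebraMap T₁ (K i₁)))
    {C : Type} [Fintype C] {J₀ J₁ : Type} [Fintype J₀] [Fintype J₁] (c₀ : J₀ → C) (c₁ : J₁ → C)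
    {δ : C → ℕ} (hδ : Function.Injective δ)
    {A₀ : J₀ → Submodule ℚ ((T₀ →+* ℂ) → ℚ)} {A₁ : J₁ → Submodule ℚ ((T₁ →+* ℂ) → ℚ)}
    (hA₀st : ∀ (j : J₀) (k : ℂ ≃+* ℂ) (a : (T₀ →+* ℂ) → ℚ), a ∈ A₀ j → (fun y => a (k • y)) ∈ A₀ j)
    (hA₀irr : ∀ (j : J₀) (W : Submodule ℚ ((T₀ →+* ℂ) → ℚ)), W ≤ A₀ j → W ≠ ⊥ →
      (∀ (k : ℂ ≃+* ℂ) (f : (T₀ →+* ℂ) → ℚ), f ∈ W → (fun y => f (k • y)) ∈ W) → W = A₀ j)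
    (hA₁st : ∀ (j : J₁) (k : ℂ ≃+* ℂ) (a : (T₁ →+* ℂ) → ℚ), a ∈ A₁ j → (fun y => a (k • y)) ∈ A₁ j)
    (hA₁irr : ∀ (j : J₁) (W : Submodule ℚ ((T₁ →+* ℂ) → ℚ)), W ≤ A₁ j → W ≠ ⊥ →
      (∀ (k : ℂ ≃+* ℂ) (f : (T₁ →+* ℂ) → ℚ), f ∈ W → (fun y => f (k • y)) ∈ W) → W = A₁ j)
    (hd₀ : ∀ j, Module.finrank ℚ (A₀ j) = δ (c₀ j)) (hd₁ : ∀ j, Module.finrank ℚ (A₁ j) = δ (c₁ j))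
    (hsum₀ : antiWeights (E := T₀ →+* ℂ) (starRingAut : ℂ ≃+* ℂ) ≤ ⨆ j, A₀ j)
    (hsum₁ : antiWeights (E := T₁ →+* ℂ) (starRingAut : ℂ ≃+* ℂ) ≤ ⨆ j, A₁ j) :
    ∃ (p₀ : C → ((T₀ →+* ℂ) → ℚ)) (p₁ : C → ((T₁ →+* ℂ) → ℚ)),
      (∀ c, p₀ c ∈ ⨆ j : {j // c₀ j = c}, A₀ j.1) ∧ (∀ c, p₁ c ∈ ⨆ j : {j // c₁ j = c}, A₁ j.1) ∧
      (fun y : T₀ →+* ℂ => ∑ t ∈ Finset.univ.filter (fun t : K i₀ →+* ℂ => t.comp (algebraMap T₀ (K i₀)) = y),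
        antiVec (Φ i₀).1 (1 : ℂ ≃+* ℂ) t) = ∑ c, p₀ c ∧
      (fun y : T₁ →+* ℂ => ∑ t ∈ Finset.univ.filter (fun t : K i₁ →+* ℂ => t.comp (algebraMap T₁ (K i₁)) = y),
        antiVec (Φ i₁).1 (1 : ℂ ≃+* ℂ) t) = ∑ c, p₁ c ∧
      cmTypeRank (Φ i₀) + cmTypeRank (Φ i₁) = CMAlgebra.cmFamilyRank Φ + 1 +
        ∑ c, Module.finrank ℚ ↥(Submodule.span ℚ (Set.range fun y : T₀ →+* ℂ => fun g : ℂ ≃+* ℂ => p₀ c (g • y)) ⊓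
          Submodule.span ℚ (Set.range fun y : T₁ →+* ℂ => fun g : ℂ ≃+* ℂ => p₁ c (g • y))) ∧
      ∀ c, δ c ∣ Module.finrank ℚ ↥(Submodule.span ℚ (Set.range fun y : T₀ →+* ℂ => fun g : ℂ ≃+* ℂ => p₀ c (g • y)) ⊓
          Submodule.span ℚ (Set.range fun y : T₁ →+* ℂ => fun g : ℂ ≃+* ℂ => p₁ c (g • y))) := by
  haveI : ∀ i, Nonempty (K i →+* ℂ) := fun i => inferInstance
  exact IrrOdd.exists_typeRank_add_typeRank_eq_add_sum_of_finrank_eq (G := ℂ ≃+* ℂ) (E := fun i => K i →+* ℂ)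
    (Φ := fun i => (Φ i).1) (fun i => isCMTypeWith_conj (Φ i)) hI h01
    (fun t : K i₀ →+* ℂ => t.comp (algebraMap T₀ (K i₀))) (fun t : K i₁ →+* ℂ => t.comp (algebraMap T₁ (K i₁)))
    (fun _ _ => rfl) (fun _ _ => rfl) (exists_stab_smul_eq_of_comp_eq_of_trace_le i₁ htr₀)
    (exists_stab_smul_eq_of_comp_eq_of_trace_le i₀ htr₁) c₀ c₁ hδ hA₀st hA₀irr hA₁st hA₁irr hd₀ hd₁
    (hsum₀ (shadow_comp_algebraMap_mem_antiWeights (Φ i₀))) (hsum₁ (shadow_comp_algebraMap_mem_antiWeights (Φ i₁)))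

end Summit.HodgeConjecture.CorCM

end
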